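import Mathlib
import Literature.Analysis.PDE.FarChannelClaimLemmas2
import Literature.Analysis.Calculus.IntervalCauchySchwarz
import HarnessLib

/-!
# Lemmas for the far-side channel claim at exponent `n = 0`: Hardy on `(1,∞)` and arithmetic

Analysis/PDE support file (everything proved; real analysis only): the Hardy inequality on
`[1, X]` against a weight (`hardy_Ioi_one`, reflected from `IntervalCauchySchwarz.lean`),
`(h X − h 1)² ≤ (X−1)∫_1^X h'²`, the weight integral `∫_1^X (x−1)P ≤ 2ε` for
`0 ≤ P ≤ ε x^{-5/2}`, the resulting bounds `∫ P(h − h 1)² ≤ 2ε ∫ h'²` and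
`h(1)² ∫_1^2 P ≤ 2∫_1^2 P h² + 2(∫_1^2 P)∫ h'²`, and the final arithmetic of the `n = 0` claim
(`FarChannelClaimZero.lean`; route PhotonSphereChannels, `FixedModeChannels`, far side, `ℓ = 0`,
stmt-FinalStateConjecture-10048). Folklore.
-/

noncomputable section

namespace Literature.Analysis.PDE

open MeasureTheory Set Filter Topology Finset Real Literature.Analysis.Calculus

/-- **Hardy inequality on `[1, X]`, vanishing at the left endpoint replaced by subtracting
`h(1)`**: `∫_1^X V (h − h(1))² ≤ (∫_1^X (x−1) V) ∫_1^X h'²`. [folklore] -/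
theorem hardy_Ioi_one {V h : ℝ → ℝ} (hV : Continuous V) (hV0 : ∀ x, 0 ≤ V x)
    (hh : ContDiff ℝ 1 h) {X : ℝ} (hX : 1 ≤ X) :
    ∫ x in (1:ℝ)..X, V x * (h x - h 1) ^ 2
      ≤ (∫ x in (1:ℝ)..X, (x - 1) * V x) * ∫ x in (1:ℝ)..X, deriv h x ^ 2 := by
  -- reflect `x ↦ −x`
  have hd : ∀ x, HasDerivAt h (deriv h x) x := fun x => ((hh.differentiable one_ne_zero) x).hasDerivAt
  have hd' : Continuous (deriv h) := hh.continuous_deriv le_rfl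
  set k : ℝ → ℝ := fun y => h (-y) - h 1 with hk
  have hk' : ∀ y, HasDerivAt k (-deriv h (-y)) y := fun y => by
    have := ((hd (-y)).comp y (hasDerivAt_neg y)).sub_const (h 1)
    simpa [hk] using this
  have h0 : k (-1) = 0 := by simp [hk]
  have hH := intervalIntegral_mul_sq_le_of_apply_eq_zero (V := fun y => V (-y)) (h := k)
    (h' := fun y => -deriv h (-y)) (hV.comp continuous_neg) (fun y => hV0 _) hk'
    ((hd'.comp continuous_neg).neg) (b := -X) (a := -1) (by linarith) h0
  have e1 : (∫ y in (-X)..(-1), V (-y) * k y ^ 2) = ∫ x in (1:ℝ)..X, V x * (h x - h 1) ^ 2 := by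
    show (∫ y in (-X)..(-1), (fun x => V x * (h x - h 1) ^ 2) (-y)) = _
    rw [intervalIntegral.integral_comp_neg (fun x => V x * (h x - h 1) ^ 2), neg_neg, neg_neg]
  have e2 : (∫ y in (-X)..(-1), (-1 - y) * V (-y)) = ∫ x in (1:ℝ)..X, (x - 1) * V x := by
    have : (fun y : ℝ => (-1 - y) * V (-y)) = fun y => (fun x => (x - 1) * V x) (-y) := by
      funext y; ring_nf
    rw [this, intervalIntegral.integral_comp_neg (fun x => (x - 1) * V x), neg_neg, neg_neg]
  have e3 : (∫ y in (-X)..(-1), (-deriv h (-y)) ^ 2) = ∫ x in (1:ℝ)..X, deriv h x ^ 2 := by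
    have : (fun y : ℝ => (-deriv h (-y)) ^ 2) = fun y => (fun x => deriv h x ^ 2) (-y) := by
      funext y; ring
    rw [this, intervalIntegral.integral_comp_neg (fun x => deriv h x ^ 2), neg_neg, neg_neg]
  rw [e1, e2, e3] at hH
  exact hH

/-- `(h X − h 1)² ≤ (X − 1) ∫_1^X h'²` for `X ≥ 1`. [folklore] -/
theorem sub_sq_le_mul_intervalIntegral {h : ℝ → ℝ} (hh : ContDiff ℝ 1 h) {X : ℝ} (hX : 1 ≤ X) :
    (h X - h 1) ^ 2 ≤ (X - 1) * ∫ x in (1:ℝ)..X, deriv h x ^ 2 := by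
  have hd' : Continuous (deriv h) := hh.continuous_deriv le_rfl
  have hftc : (∫ x in (1:ℝ)..X, deriv h x * 1) = h X - h 1 := by
    simp only [mul_one]
    exact intervalIntegral.integral_deriv_eq_sub (fun x _ => (hh.differentiable one_ne_zero) x)
      (hd'.intervalIntegrable _ _)
  have hcs := abs_intervalIntegral_mul_le_sqrt hd' continuous_const hX (g := fun _ => (1:ℝ))
  rw [hftc] at hcs
  have h1 : (∫ x in (1:ℝ)..X, (1:ℝ) ^ 2) = X - 1 := by simp
  rw [h1] at hcs
  have hA : 0 ≤ ∫ x in (1:ℝ)..X, deriv h x ^ 2 :=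
    intervalIntegral.integral_nonneg hX fun x _ => sq_nonneg _
  calc (h X - h 1) ^ 2 = |h X - h 1| ^ 2 := (sq_abs _).symm
    _ ≤ (Real.sqrt (∫ x in (1:ℝ)..X, deriv h x ^ 2) * Real.sqrt (X - 1)) ^ 2 :=
        pow_le_pow_left₀ (abs_nonneg _) hcs 2
    _ = (X - 1) * ∫ x in (1:ℝ)..X, deriv h x ^ 2 := by
        rw [mul_pow, Real.sq_sqrt hA, Real.sq_sqrt (by linarith)]; ring

/-- The weight integral `∫_1^X (x−1)P ≤ 2ε` when `0 ≤ P ≤ ε x^{-5/2}` on `x ≥ 1`.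
[folklore] -/
theorem far_zero_weight_integral {P : ℝ → ℝ} {ε : ℝ} (hPc : Continuous P) (hP0 : ∀ x, 0 ≤ P x)
    (hPb : ∀ x, 1 ≤ x → P x ≤ ε * x ^ (-(5 : ℝ) / 2)) {X : ℝ} (hX1 : 1 ≤ X) :
    (∫ x in (1:ℝ)..X, (x - 1) * P x) ≤ 2 * ε := by
  have hX0 : (0:ℝ) < X := by linarith
  have hε : 0 ≤ ε := by
    have := (hP0 1).trans (hPb 1 le_rfl); simpa using this
  have h1 : (∫ x in (1:ℝ)..X, (x - 1) * P x) ≤ ∫ x in (1:ℝ)..X, ε * x ^ (-(3:ℝ) / 2) := by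
    refine intervalIntegral.integral_mono_on hX1
      (((continuous_id.sub continuous_const).mul hPc).intervalIntegrable _ _)
      ((intervalIntegral.intervalIntegrable_rpow (Or.inr (by
        rw [uIcc_of_le hX1]; exact fun h => by linarith [h.1]))).const_mul _) fun x hx => ?_
    have hx0 : 0 < x := by linarith [hx.1]
    have hP := hPb x hx.1
    have e : x * (ε * x ^ (-(5:ℝ) / 2)) = ε * x ^ (-(3:ℝ) / 2) := by
      rw [show -(3:ℝ) / 2 = 1 + (-(5:ℝ) / 2) by norm_num, rpow_add hx0, rpow_one]; ring
    calc (x - 1) * P x ≤ x * P x := by nlinarith [hP0 x, hx.1]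
      _ ≤ x * (ε * x ^ (-(5:ℝ) / 2)) := mul_le_mul_of_nonneg_left hP hx0.le
      _ = ε * x ^ (-(3:ℝ) / 2) := e
  have h2 : (∫ x in (1:ℝ)..X, ε * x ^ (-(3:ℝ) / 2)) ≤ 2 * ε := by
    rw [intervalIntegral.integral_const_mul, integral_rpow (Or.inr ⟨by norm_num, by
      rw [uIcc_of_le hX1]; exact fun h => by linarith [h.1]⟩), one_rpow]
    have hXr : 0 ≤ X ^ (-(3:ℝ) / 2 + 1) := rpow_nonneg hX0.le _
    have : ((X ^ (-(3:ℝ) / 2 + 1) - 1) / (-(3:ℝ) / 2 + 1)) = 2 * (1 - X ^ (-(3:ℝ) / 2 + 1)) := by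
      rw [div_eq_iff (by norm_num)]; ring
    rw [this]; nlinarith
  exact h1.trans h2

/-- **Hardy on `(1,∞)` against `P`**: `∫_{x>1} P (h − h(1))² ≤ 2ε ∫_{x>1} h'²`. [folklore] -/
theorem far_zero_hardy {P h : ℝ → ℝ} {ε : ℝ} (hPc : Continuous P) (hP0 : ∀ x, 0 ≤ P x)
    (hPb : ∀ x, 1 ≤ x → P x ≤ ε * x ^ (-(5 : ℝ) / 2)) (hh : ContDiff ℝ 1 h)
    (hi : IntegrableOn (fun x => deriv h x ^ 2) (Ioi 1)) :
    IntegrableOn (fun x => P x * (h x - h 1) ^ 2) (Ioi 1) ∧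
      (∫ x in Ioi 1, P x * (h x - h 1) ^ 2) ≤ 2 * ε * ∫ x in Ioi 1, deriv h x ^ 2 := by
  set H : ℝ := ∫ x in Ioi 1, deriv h x ^ 2 with hH
  have hH0 : 0 ≤ H := setIntegral_nonneg measurableSet_Ioi fun x _ => sq_nonneg _
  have hε : 0 ≤ ε := by
    have := (hP0 1).trans (hPb 1 le_rfl); simpa using this
  have hHX : ∀ X, 1 ≤ X → (∫ x in (1:ℝ)..X, deriv h x ^ 2) ≤ H := by
    intro X hX1
    rw [intervalIntegral.integral_of_le hX1]
    exact setIntegral_mono_set hi (ae_of_all _ fun x => sq_nonneg _) (ae_of_all _ Ioc_subset_Ioi_self)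
  have hc : Continuous fun x => P x * (h x - h 1) ^ 2 :=
    hPc.mul ((hh.continuous.sub continuous_const).pow 2)
  refine integrableOn_Ioi_of_intervalIntegral_le hc (fun x _ => mul_nonneg (hP0 x) (sq_nonneg _))
    fun X hX1 => ?_
  have hw0 : 0 ≤ ∫ x in (1:ℝ)..X, (x - 1) * P x :=
    intervalIntegral.integral_nonneg hX1 fun x hx => mul_nonneg (by linarith [hx.1]) (hP0 x)
  calc (∫ x in (1:ℝ)..X, P x * (h x - h 1) ^ 2)
      ≤ (∫ x in (1:ℝ)..X, (x - 1) * P x) * ∫ x in (1:ℝ)..X, deriv h x ^ 2 :=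
        hardy_Ioi_one hPc hP0 hh hX1
    _ ≤ (2 * ε) * H := mul_le_mul (far_zero_weight_integral hPc hP0 hPb hX1) (hHX X hX1)
        (intervalIntegral.integral_nonneg hX1 fun x _ => sq_nonneg _) (by positivity)
    _ = 2 * ε * H := by ring

/-- **The constant direction**: `h(1)² ∫_1^2 P ≤ 2 ∫_1^2 P h² + 2 (∫_1^2 P) ∫_{x>1} h'²`.
[folklore] -/
theorem far_zero_const_sq {P h : ℝ → ℝ} (hPc : Continuous P) (hP0 : ∀ x, 0 ≤ P x)
    (hh : ContDiff ℝ 1 h) (hi : IntegrableOn (fun x => deriv h x ^ 2) (Ioi 1)) :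
    h 1 ^ 2 * (∫ x in (1:ℝ)..2, P x) ≤ 2 * (∫ x in (1:ℝ)..2, P x * h x ^ 2)
      + 2 * (∫ x in Ioi 1, deriv h x ^ 2) * ∫ x in (1:ℝ)..2, P x := by
  set H : ℝ := ∫ x in Ioi 1, deriv h x ^ 2 with hH
  have hHX : ∀ X, 1 ≤ X → (∫ x in (1:ℝ)..X, deriv h x ^ 2) ≤ H := by
    intro X hX1
    rw [intervalIntegral.integral_of_le hX1]
    exact setIntegral_mono_set hi (ae_of_all _ fun x => sq_nonneg _) (ae_of_all _ Ioc_subset_Ioi_self)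
  have hpt : ∀ x ∈ Icc (1:ℝ) 2, P x * h 1 ^ 2 ≤ 2 * (P x * h x ^ 2) + 2 * H * P x := by
    intro x hx
    have h1 := sub_sq_le_mul_intervalIntegral hh hx.1
    have h2 : (h x - h 1) ^ 2 ≤ H := by
      refine h1.trans ?_
      calc (x - 1) * ∫ y in (1:ℝ)..x, deriv h y ^ 2 ≤ 1 * H :=
            mul_le_mul (by linarith [hx.2]) (hHX x hx.1)
              (intervalIntegral.integral_nonneg hx.1 fun y _ => sq_nonneg _) zero_le_one
        _ = H := one_mul _
    have hPx := hP0 x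
    nlinarith [mul_nonneg hPx (sq_nonneg (2 * h x - h 1)), mul_le_mul_of_nonneg_left h2 hPx]
  have hPh : IntervalIntegrable (fun x => P x * h x ^ 2) volume 1 2 :=
    (hPc.mul (hh.continuous.pow 2)).intervalIntegrable _ _
  have hint2 : (∫ x in (1:ℝ)..2, P x * h 1 ^ 2)
      ≤ ∫ x in (1:ℝ)..2, (2 * (P x * h x ^ 2) + 2 * H * P x) :=
    intervalIntegral.integral_mono_on (by norm_num) ((hPc.mul continuous_const).intervalIntegrable
      _ _) ((hPh.const_mul _).add ((hPc.intervalIntegrable _ _).const_mul _)) hpt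
  rw [intervalIntegral.integral_add (hPh.const_mul _) ((hPc.intervalIntegrable _ _).const_mul _),
    intervalIntegral.integral_const_mul, intervalIntegral.integral_const_mul,
    intervalIntegral.integral_mul_const] at hint2
  linarith

/-- The final arithmetic of the `n = 0` claim. [folklore] -/
theorem far_claim_zero_arith {X H S L Ed ε r c Kc a δ δ₁ : ℝ} (hc : 0 < c) (hKc : 0 ≤ Kc)
    (hε : 0 ≤ ε) (hε1 : ε ≤ 1) (hr : 0 ≤ r) (hr1 : r ≤ 1) (hEd : 0 ≤ Ed) (hH : 0 ≤ H)
    (hS0 : 0 ≤ S)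
    (hE : X ≤ 2 * ((1 + 0) * ((1 + 2 * ε) * S) / c) + 2 * (Kc * ε ^ 2 * a ^ 2))
    (hHS : H ≤ S / c) (ha : ε ^ 2 * a ^ 2 ≤ r * (2 * Ed + 2 * ε * H))
    (hSb : S ≤ 2 * L + 256 * ε * Ed + δ₁) (hδ : (6 + 4 * Kc) / c * δ₁ ≤ δ) :
    X ≤ 2 * (6 + 4 * Kc) / c * L + (256 * (6 + 4 * Kc) / c + 4 * Kc) * (ε + r) * Ed + δ := by
  have hSc : 0 ≤ S / c := div_nonneg hS0 hc.le
  have h1 : X ≤ 2 * (S / c) + 4 * ε * (S / c) + 2 * Kc * (r * (2 * Ed + 2 * ε * (S / c))) := by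
    have e : 2 * ((1 + 0) * ((1 + 2 * ε) * S) / c) = 2 * (S / c) + 4 * ε * (S / c) := by ring
    have hJ' : Kc * ε ^ 2 * a ^ 2 ≤ Kc * (r * (2 * Ed + 2 * ε * H)) := by
      rw [mul_assoc]; exact mul_le_mul_of_nonneg_left ha hKc
    have hJ'' : Kc * (r * (2 * Ed + 2 * ε * H)) ≤ Kc * (r * (2 * Ed + 2 * ε * (S / c))) := by
      refine mul_le_mul_of_nonneg_left (mul_le_mul_of_nonneg_left ?_ hr) hKc; nlinarith
    linarith
  have h2 : X ≤ (6 + 4 * Kc) * (S / c) + 4 * Kc * r * Ed := by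
    have e1 : 4 * ε * (S / c) ≤ 4 * (S / c) := by nlinarith
    have e2 : 2 * Kc * (r * (2 * ε * (S / c))) ≤ 4 * Kc * (S / c) := by
      have : r * (2 * ε * (S / c)) ≤ 2 * (S / c) := by
        have h3 : r * ε ≤ 1 := by nlinarith
        nlinarith [mul_nonneg (mul_nonneg hr hε) hSc]
      nlinarith
    nlinarith
  have h3 : (6 + 4 * Kc) * (S / c) ≤ (6 + 4 * Kc) / c * (2 * L + 256 * ε * Ed + δ₁) := by
    rw [show (6 + 4 * Kc) * (S / c) = (6 + 4 * Kc) / c * S by ring]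
    exact mul_le_mul_of_nonneg_left hSb (by positivity)
  have h4 : (256 * (6 + 4 * Kc) / c) * ε * Ed + 4 * Kc * r * Ed
      ≤ (256 * (6 + 4 * Kc) / c + 4 * Kc) * (ε + r) * Ed := by
    have : 0 ≤ (256 * (6 + 4 * Kc) / c) * r * Ed + 4 * Kc * ε * Ed := by positivity
    nlinarith
  have e5 : (6 + 4 * Kc) / c * (2 * L + 256 * ε * Ed + δ₁)
      = 2 * (6 + 4 * Kc) / c * L + (256 * (6 + 4 * Kc) / c) * ε * Ed + (6 + 4 * Kc) / c * δ₁ := by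
    ring
  linarith

/-- **Size of the constant direction for `n = 0`**: with `a = h(1)`, `H = ∫ h'²`, `E_d` the data
energy and `∫_1^2 P ≤ ε`, the non-degeneracy `ε² ≤ r ∫_1^2 P` gives `ε² a² ≤ r(2E_d + 2εH)`.
[folklore] -/
theorem far_claim_zero_direction {P : ℝ → ℝ} {φ : ℝ → ℝ → ℝ} {ε r : ℝ}
    (hPc : Continuous P) (hP0 : ∀ z, 0 ≤ P z) (hh : ContDiff ℝ 2 (φ 0))
    (i1 : IntegrableOn (fun x => deriv (φ 0) x ^ 2) (Ioi 1))
    (hint : IntegrableOn (fun z => deriv (fun τ => φ τ z) 0 ^ 2 + deriv (φ 0) z ^ 2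
      + P z * φ 0 z ^ 2) (Ioi 1))
    (hPε : ∀ x, 1 ≤ x → P x ≤ ε) (hr : 0 ≤ r) (hrP : ε ^ 2 ≤ r * ∫ x in (1:ℝ)..2, P x) :
    ε ^ 2 * φ 0 1 ^ 2 ≤ r * (2 * (∫ z in Ioi 1, (deriv (fun τ => φ τ z) 0 ^ 2 + deriv (φ 0) z ^ 2
      + P z * φ 0 z ^ 2)) + 2 * ε * ∫ x in Ioi 1, deriv (φ 0) x ^ 2) := by
  set Ed : ℝ := ∫ z in Ioi 1, (deriv (fun τ => φ τ z) 0 ^ 2 + deriv (φ 0) z ^ 2 + P z * φ 0 z ^ 2)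
    with hEd
  set H : ℝ := ∫ x in Ioi 1, deriv (φ 0) x ^ 2 with hHdef
  have hH0 : 0 ≤ H := setIntegral_nonneg measurableSet_Ioi fun x _ => sq_nonneg _
  have hp0 : 0 ≤ ∫ x in (1:ℝ)..2, P x := intervalIntegral.integral_nonneg (by norm_num)
    fun x _ => hP0 x
  have hpε : (∫ x in (1:ℝ)..2, P x) ≤ ε := by
    have h1 : (∫ x in (1:ℝ)..2, P x) ≤ ∫ x in (1:ℝ)..2, ε :=
      intervalIntegral.integral_mono_on (by norm_num) (hPc.intervalIntegrable _ _)
        (continuous_const.intervalIntegrable _ _) fun x hx => hPε x hx.1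
    rw [intervalIntegral.integral_const, smul_eq_mul] at h1; linarith
  have hcs := far_zero_const_sq hPc hP0 (hh.of_le (by norm_num)) i1
  have hPh : IntervalIntegrable (fun x => P x * φ 0 x ^ 2) volume 1 2 :=
    (hPc.mul (hh.continuous.pow 2)).intervalIntegrable _ _
  have hPhE : (∫ x in (1:ℝ)..2, P x * φ 0 x ^ 2) ≤ Ed := by
    rw [intervalIntegral.integral_of_le (by norm_num)]
    calc (∫ x in Ioc (1:ℝ) 2, P x * φ 0 x ^ 2)
        ≤ ∫ x in Ioc (1:ℝ) 2, (deriv (fun τ => φ τ x) 0 ^ 2 + deriv (φ 0) x ^ 2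
          + P x * φ 0 x ^ 2) :=
          setIntegral_mono_on hPh.1 (hint.mono_set Ioc_subset_Ioi_self) measurableSet_Ioc
            fun x _ => by nlinarith [sq_nonneg (deriv (fun τ => φ τ x) 0), sq_nonneg (deriv (φ 0) x)]
      _ ≤ Ed := setIntegral_mono_set hint (ae_of_all _ fun x => by
          have := hP0 x; positivity) (ae_of_all _ Ioc_subset_Ioi_self)
  have hap : φ 0 1 ^ 2 * (∫ x in (1:ℝ)..2, P x) ≤ 2 * Ed + 2 * ε * H := by
    have := mul_le_mul_of_nonneg_left hpε hH0
    nlinarith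
  calc ε ^ 2 * φ 0 1 ^ 2 ≤ (r * ∫ x in (1:ℝ)..2, P x) * φ 0 1 ^ 2 :=
        mul_le_mul_of_nonneg_right hrP (sq_nonneg _)
    _ = r * (φ 0 1 ^ 2 * ∫ x in (1:ℝ)..2, P x) := by ring
    _ ≤ r * (2 * Ed + 2 * ε * H) := mul_le_mul_of_nonneg_left hap hr

end Literature.Analysis.PDE
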